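import Literature.IUT.HodgeTheaters.TemperedCoveringsCor23KerLevelOfTower
import Literature.IUT.HodgeTheaters.TemperedCoveringsCor23iiOfSpecialFibre
import Literature.IUT.HodgeTheaters.CommensuratorLemmas
import Literature.AnabelianGeometry.SemiGraphs.ArithEdgeLikeTwoHosts
import Literature.AnabelianGeometry.SemiGraphs.TemperedMaximalCompact
import HarnessLib

/-!
# [IUTchI] Cor. 2.3 (i)–(v) at the GENUINE 𝔛-datum for `ℍ` = ONE VERTEX (`Π^tp_ℍ` a verticial subgroup; [IUTchII]'s `Γ^•t_X`):
# (v) UNCONDITIONAL for every COMPACT `Π^tp_ℍ`, and the law `C_{π₁^temp}(Π^tp_ℍ) = Π^tp_ℍ` DISCHARGED by [SemiAnbd] Thm. 3.7 (ii)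

Mochizuki, *Inter-universal Teichmüller theory I: construction of Hodge theaters*, kurims manuscript
(May 2020), §2, Corollary 2.3 (i) p. 47 l. 31–35, (iv) p. 47 l. 44–46, (v) p. 48 l. 1–2; proofs p. 48 l. 13
("Assertion (i) follows immediately from Proposition 2.2"), p. 49 l. 33–34 ("assertion (iv) follows immediately
from assertion (i)"), p. 49 l. 38 – p. 50 l. 2 ("it suffices to verify that … `F̂ ⋂ G = F`")
[cite: Mochizuki2012, Cor 2.3 pp.47-50] (D-0012 claim key; series status DISPUTED; nothing of the series is
asserted here), over Mochizuki, *Semi-graphs of anabelioids*, Publ. RIMS **42** (2006), Ex. 3.10 pp. 43–45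
[cite: MochizukiSemiAnbd2006, Ex 3.10 pp.43-45].
[IUTchII] (Dec. 2020) §2 Rmk. 2.1.1 (ii) p. 65 (`Γ^•t_X` = ONE VERTEX), Prop. 2.2 (i) p. 66 l. 27–35 («`Π_{v•t} ⊆ Π_v` … the group
"`Π^tp_{X,ℍ}`" of [IUTchI], Cor. 2.3») [cite: Mochizuki2012, IUTchII Rmk 2.1.1(ii) p.65; Prop 2.2(i) p.66]; [SemiAnbd] Thm. 3.7
(i)/(ii) p. 40 ("[necessarily compact!]"; commensurably terminal) [cite: MochizukiSemiAnbd2006, Thm 3.7 p.40].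

PROOF-ONLY companion (abc-iut cell, R-C discharge re-arm W9 (i), seat abc-iut-w5-d028 — holder of record of the index rows
`IUTchI:Cor2.3(i)`, `(iv)`, `(v)`, `IUTchI:Cor2.5`; sequel of `TemperedCoveringsCor23GraphLevelResiduals` /
`TemperedCoveringsCor23OfSpecialFibreCommTerminal`, same seat).  No definition, no new `Prop` fact, no statement file edited.

At the genuine datum `𝔇 := StableCurveTemperedData.ofSpecialFibre X d S h36 …` (abc-iut-L5-t11) with print's parameter
`Π̂_ℍ :=` the closure of `ι(Π^tp_ℍ)` in `Π̂_𝔾`, the bridge's `Π^tp_ℍ` is a bare PARAMETER `TpH ≤ π₁^temp(G^c)` and the rows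
(i)/(v) are EQUIVALENT to 𝔾-level laws on it (`cor23i_iff_graph`, `cor23v_iff_comap`).  For the sub-semi-graph that
[IUTchII] Cor. 2.4 / Prop. 2.2 actually use besides `Γ^▶`, namely `ℍ = Γ^•t_X` = ONE VERTEX `v`, print's `Π^tp_{𝔾,ℍ}` is the
VERTICIAL SUBGROUP `Π_v` (the image of `π̂₁(𝒢_v) → π₁^temp(𝒢)`, [SemiAnbd] Thm. 3.7 (i); tree: `verticialSubgroups S.chart v`,
abc-iut-L3-t2), and two of those laws are THEOREMS of the L3 tree:

* **(v) UNCONDITIONAL for every COMPACT parameter** — `cor23v_ofSpecialFibre_closureH_of_isCompact (hc : IsCompact ↑TpH)`: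
  `ι(TpH)` is compact in the Hausdorff `Π̂_𝔾`, hence closed, so `Π̂_ℍ = closure ι(TpH) = ι(TpH)` and `Π̂_ℍ ∩ Π^tp_𝔾 = ι(Π^tp_ℍ)`
  (abc-iut-L5-d4's `cor23v_of_graph`; print's "`F̂ ⋂ G = F`" is trivial for compact `F`); in particular
  `cor23v_ofSpecialFibre_closureH_of_mem_verticialSubgroups` (`isCompact_of_mem_verticialSubgroups`, "[necessarily compact!]").
* **(i) with `htp` DISCHARGED** — `cor23i_ofSpecialFibre_closureH_of_mem_verticialSubgroups (hH : TpH ∈ verticialSubgroups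
  S.chart v) (hhat)`: the law `htp : C_{π₁^temp(G^c)}(Π_v) = Π_v` IS [SemiAnbd] Thm. 3.7 (ii), a kernel theorem under
  `S.hyp : Thm37Hypotheses` (abc-iut-L3 `commensurator_eq_of_mem_verticialSubgroups`, via `verticialDistinct_holds`); the
  profinite-side law `hhat : C_{Π̂_𝔾}(Π̂_ℍ) = Π̂_ℍ` remains ([SemiAnbd] Cor. 2.7 (i) / [CombGC] Prop. 1.2 (ii) at the profinite
  completion — FACT-policy F-1458 route, abc-iut-w4-d071 `hatH_commTerminal`; GAP-LEDGER G-w5d028-1 and G-w5d028-2 (P3)); for compact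
  `TpH` it can be supplied in EITHER printed form, `C(closure ι TpH)` or `C(ι TpH)` = Prop. 2.2's clause `tpH_in_hat`
  (`map_topologicalClosure_eq_of_isCompact`, `cor23i_ofSpecialFibre_closureH_of_mem_verticialSubgroups'`).
* **(i)–(iv) block over L3's `SpecialFibreTower.PiData`, `ℍ` = one vertex** —
  `cor23_i_to_iv_ofSpecialFibre_closureH_of_piData_of_mem_verticialSubgroups (P) (hA) (hB) (hH) (hhat) (hHstab)`: the layer-5
  certificate's route (α) §2 law list `{h22, hHstab, hA, hB}` + `hv` (`Summits/ABC/IUTFork/Conditional/Layer5OfSV06.lean`) becomes,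
  AT THIS `ℍ`, `{hhat, hHstab, hA, hB}` and NO `hv`: −1 law and `h22` (4 clauses) ↦ `hhat` (1 clause).  Assembly = abc-iut-w4-d058's
  p438500 chain BY NAME ((ii) `cor23ii_ofSpecialFibre`; descent `ofSpecialFibre_outerTp_of_graphStable` + `outerHat_of_outerTp`;
  slimness `kerLevel_all_ofSpecialFibre_of_towerLevels` + `slim_of_cor23Hyp_of_levels`; `cor23iii/iv_ofSpecialFibre_of_slim`).

HONEST RESIDUAL at `ℍ = {v}`: `hhat` (FACT route), `hHstab` ("`v` is `G_k`-fixed", p. 47 l. 25–26; not recorded by the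
interface), the per-level KER-LEVEL inputs `hA`/`hB` of (iii) (G-w4d058-1), the cusp incidences of (vi), Prop. 2.4 (i)/(ii) for
Cor. 2.5.  That `Π^tp_{𝔾,Γ•t}` IS `Π_{v_t}` (one vertex, no closed edge in `ℍ`) is print's definition (p. 44 l. 39–44) read at a
one-vertex sub-semi-graph; general `ℍ` (e.g. `Γ^▶`) needs the L3 construction G-w5d028-2.  Model-RELATIVE; typed ≠ discharged;
a binder is an assumption label; nothing here bears on [IUTchIII] Cor. 3.12 or asserts that abc is proved or refuted.
-/

noncomputable section

namespace Literature.IUT.HodgeTheaters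

open _root_.Topology
open scoped Pointwise
open Literature.AnabelianGeometry.SemiGraphs
open Literature.AnabelianGeometry.SemiGraphs.ProfiniteSemiGraph (verticialSubgroups
  isCompact_of_mem_verticialSubgroups commensurator_eq_of_mem_verticialSubgroups)
open Literature.AnabelianGeometry.AbsoluteAnabelian (IsCommensurablyTerminal)
open Literature.AlgebraicGeometry.Frobenioids (IsSlimGroup)
open Literature.IUT.HodgeTheaters.IsCommensurablyTerminal (comap_of_surjective)

namespace StableCurveTemperedData

/-! ### A. Compact parameters: the closure of `ι(Π^tp_ℍ)` is `ι(Π^tp_ℍ)`; Cor. 2.3 (v) unconditional -/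

section Compact

variable {p : ℕ} [Fact p.Prime] (X : TemperedCurve p) (d : X.GroupLevelData)
  (S : SpecialFibreData (X.toTemperedArithmeticGroup d)) (h36 : S.Gc.Prop36Hypotheses)
  (Sigma SigmaHat : Set ℕ) (hsub : Sigma ⊆ SigmaHat) (hne : Sigma.Nonempty)
  (hprime : ∀ q ∈ SigmaHat, q.Prime) (hp : p ∉ Sigma)
  (TpH : Subgroup S.chart.G)
  (cuspMeetsH : {x : X.Pt // X.IsCusp x} → Prop)

/-- For a COMPACT parameter `Π^tp_ℍ = TpH`, print's `Π̂_ℍ :=` closure of `ι(TpH)` in the Hausdorff `Π̂_𝔾` IS `ι(TpH)`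
(compact image is closed). [cite: MochizukiSemiAnbd2006, Thm 3.7(i) p.40] -/
theorem map_topologicalClosure_eq_of_isCompact (hc : IsCompact (TpH : Set S.chart.G)) :
    ((TpH.map (TemperedGraphGroupData.exists_completion_of_prop36 S.Gc h36 S.chart).choose_spec.choose.toMonoidHom).topologicalClosure) =
      TpH.map (TemperedGraphGroupData.exists_completion_of_prop36 S.Gc h36 S.chart).choose_spec.choose.toMonoidHom := by
  haveI : T2Space (TemperedGraphGroupData.exists_completion_of_prop36 S.Gc h36 S.chart).choose := (OfSpecialFibre.iotaG_isProfiniteCompletion X d S h36).t2Space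
  refine le_antisymm (Subgroup.topologicalClosure_minimal _ le_rfl ?_) (Subgroup.le_topologicalClosure _)
  rw [Subgroup.coe_map]
  exact (hc.image (TemperedGraphGroupData.exists_completion_of_prop36 S.Gc h36 S.chart).choose_spec.choose.continuous).isClosed

/-- For a compact parameter, `ι⁻¹(Π̂_ℍ) = Π^tp_ℍ` (injectivity of `ι`). [cite: Mochizuki2012, Cor 2.3(v) p.49] -/
theorem comap_topologicalClosure_eq_of_isCompact (hc : IsCompact (TpH : Set S.chart.G)) :
    ((TpH.map (TemperedGraphGroupData.exists_completion_of_prop36 S.Gc h36 S.chart).choose_spec.choose.toMonoidHom).topologicalClosure).comap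
        (TemperedGraphGroupData.exists_completion_of_prop36 S.Gc h36 S.chart).choose_spec.choose.toMonoidHom = TpH := by
  rw [map_topologicalClosure_eq_of_isCompact X d S h36 TpH hc]
  exact Subgroup.comap_map_eq_self_of_injective
    (TemperedGraphGroupData.exists_completion_of_prop36 S.Gc h36 S.chart).choose_spec.choose_spec.2 TpH

/-- **Row `IUTchI:Cor2.3(v)` UNCONDITIONAL at the genuine datum for every COMPACT parameter `Π^tp_ℍ`** (print's `Π̂_ℍ :=`
closure): `Δ̂_{X,ℍ} ∩ Δ^tp_X = Δ^tp_{X,ℍ}` — via abc-iut-L5-d4's `cor23v_of_graph`, the 𝔾-level identity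
`Π̂_ℍ ∩ Π^tp_𝔾 = ι(Π^tp_ℍ)` holding because `Π̂_ℍ = ι(Π^tp_ℍ)`. [cite: Mochizuki2012, Cor 2.3(v) pp.48-50] -/
theorem cor23v_ofSpecialFibre_closureH_of_isCompact (hc : IsCompact (TpH : Set S.chart.G)) :
    (ofSpecialFibre X d S h36 Sigma SigmaHat hsub hne hprime hp TpH
      ((TpH.map (TemperedGraphGroupData.exists_completion_of_prop36 S.Gc h36
        S.chart).choose_spec.choose.toMonoidHom).topologicalClosure) (Subgroup.le_topologicalClosure _) cuspMeetsH).Cor23v := by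
  refine (ofSpecialFibre X d S h36 Sigma SigmaHat hsub hne hprime hp TpH
      ((TpH.map (TemperedGraphGroupData.exists_completion_of_prop36 S.Gc h36
        S.chart).choose_spec.choose.toMonoidHom).topologicalClosure) (Subgroup.le_topologicalClosure _) cuspMeetsH).cor23v_of_graph (Set.Subset.antisymm ?_ ?_)
  · rintro _ ⟨hyH, ⟨t, rfl⟩⟩
    have h' : (TemperedGraphGroupData.exists_completion_of_prop36 S.Gc h36 S.chart).choose_spec.choose.toMonoidHom t ∈
        ((TpH.map (TemperedGraphGroupData.exists_completion_of_prop36 S.Gc h36 S.chart).choose_spec.choose.toMonoidHom).topologicalClosure) := hyH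
    rw [map_topologicalClosure_eq_of_isCompact X d S h36 TpH hc] at h'
    obtain ⟨s, hs, hst⟩ := h'
    have hst' : s = t :=
      (TemperedGraphGroupData.exists_completion_of_prop36 S.Gc h36 S.chart).choose_spec.choose_spec.2 hst
    subst hst'
    exact ⟨s, hs, rfl⟩
  · rintro _ ⟨t, ht, rfl⟩
    exact ⟨(ofSpecialFibre X d S h36 Sigma SigmaHat hsub hne hprime hp TpH
      ((TpH.map (TemperedGraphGroupData.exists_completion_of_prop36 S.Gc h36
        S.chart).choose_spec.choose.toMonoidHom).topologicalClosure) (Subgroup.le_topologicalClosure _) cuspMeetsH).graph.tpH_le ⟨t, ht, rfl⟩, ⟨t, rfl⟩⟩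

/-- **Row `IUTchI:Cor2.3(v)` UNCONDITIONAL at the genuine datum for `Π^tp_ℍ := Π_v` a VERTICIAL subgroup** (`ℍ` = one vertex,
[IUTchII] Rmk. 2.1.1 (ii) `Γ^•t_X`; "[necessarily compact!]", [SemiAnbd] Thm. 3.7 (i)). [cite: Mochizuki2012, Cor 2.3(v) p.48] -/
theorem cor23v_ofSpecialFibre_closureH_of_mem_verticialSubgroups {v : S.Gc.graph.Vertex}
    (hH : TpH ∈ verticialSubgroups S.chart v) :
    (ofSpecialFibre X d S h36 Sigma SigmaHat hsub hne hprime hp TpH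
      ((TpH.map (TemperedGraphGroupData.exists_completion_of_prop36 S.Gc h36
        S.chart).choose_spec.choose.toMonoidHom).topologicalClosure) (Subgroup.le_topologicalClosure _) cuspMeetsH).Cor23v :=
  cor23v_ofSpecialFibre_closureH_of_isCompact X d S h36 Sigma SigmaHat hsub hne hprime hp TpH cuspMeetsH
    (isCompact_of_mem_verticialSubgroups S.chart hH)

/-! ### B. `ℍ` = one vertex: the law `C_{π₁^temp(G^c)}(Π^tp_ℍ) = Π^tp_ℍ` is [SemiAnbd] Thm. 3.7 (ii) -/

/-- **Row `IUTchI:Cor2.3(i)` at the genuine datum for `Π^tp_ℍ := Π_v` verticial, from `hhat` ALONE**: the tempered-side law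
`C_{π₁^temp(G^c)}(Π_v) = Π_v` is abc-iut-L3's `commensurator_eq_of_mem_verticialSubgroups` ([SemiAnbd] Thm. 3.7 (ii) under
`S.hyp`); remaining binder `hhat : C_{Π̂_𝔾}(Π̂_ℍ) = Π̂_ℍ` ([SemiAnbd] Cor. 2.7 (i) / [CombGC] Prop. 1.2 (ii), profinite side).
[cite: Mochizuki2012, Cor 2.3(i) pp.47-48] -/
theorem cor23i_ofSpecialFibre_closureH_of_mem_verticialSubgroups {v : S.Gc.graph.Vertex}
    (hH : TpH ∈ verticialSubgroups S.chart v)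
    (hhat : IsCommensurablyTerminal ((TpH.map (TemperedGraphGroupData.exists_completion_of_prop36 S.Gc h36 S.chart).choose_spec.choose.toMonoidHom).topologicalClosure)) :
    (ofSpecialFibre X d S h36 Sigma SigmaHat hsub hne hprime hp TpH
      ((TpH.map (TemperedGraphGroupData.exists_completion_of_prop36 S.Gc h36
        S.chart).choose_spec.choose.toMonoidHom).topologicalClosure) (Subgroup.le_topologicalClosure _) cuspMeetsH).Cor23i :=
  ⟨⟨comap_of_surjective (ofSpecialFibre X d S h36 Sigma SigmaHat hsub hne hprime hp TpH
      ((TpH.map (TemperedGraphGroupData.exists_completion_of_prop36 S.Gc h36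
        S.chart).choose_spec.choose.toMonoidHom).topologicalClosure) (Subgroup.le_topologicalClosure _) cuspMeetsH).ρTp
        (ofSpecialFibre X d S h36 Sigma SigmaHat hsub hne hprime hp TpH
      ((TpH.map (TemperedGraphGroupData.exists_completion_of_prop36 S.Gc h36
        S.chart).choose_spec.choose.toMonoidHom).topologicalClosure) (Subgroup.le_topologicalClosure _) cuspMeetsH).ρTp_surjective
        (commensurator_eq_of_mem_verticialSubgroups S.hyp S.chart hH)⟩,
    ⟨comap_of_surjective (ofSpecialFibre X d S h36 Sigma SigmaHat hsub hne hprime hp TpH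
      ((TpH.map (TemperedGraphGroupData.exists_completion_of_prop36 S.Gc h36
        S.chart).choose_spec.choose.toMonoidHom).topologicalClosure) (Subgroup.le_topologicalClosure _) cuspMeetsH).ρHat
        (ofSpecialFibre X d S h36 Sigma SigmaHat hsub hne hprime hp TpH
      ((TpH.map (TemperedGraphGroupData.exists_completion_of_prop36 S.Gc h36
        S.chart).choose_spec.choose.toMonoidHom).topologicalClosure) (Subgroup.le_topologicalClosure _) cuspMeetsH).ρHat_surjective hhat.commensurator_eq⟩⟩

/-- The same with the profinite-side law in Prop. 2.2's `tpH_in_hat` form `C_{Π̂_𝔾}(ι Π_v) = ι Π_v` (for compact `Π^tp_ℍ` the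
clauses `hatH` and `tpH_in_hat` of `CommensuratorsOfDecompositionSubgroups` coincide, `map_topologicalClosure_eq_of_isCompact`).
[cite: Mochizuki2012, Prop 2.2 p.45] -/
theorem cor23i_ofSpecialFibre_closureH_of_mem_verticialSubgroups' {v : S.Gc.graph.Vertex}
    (hH : TpH ∈ verticialSubgroups S.chart v)
    (hhat' : IsCommensurablyTerminal
      (TpH.map (TemperedGraphGroupData.exists_completion_of_prop36 S.Gc h36 S.chart).choose_spec.choose.toMonoidHom)) :
    (ofSpecialFibre X d S h36 Sigma SigmaHat hsub hne hprime hp TpH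
      ((TpH.map (TemperedGraphGroupData.exists_completion_of_prop36 S.Gc h36
        S.chart).choose_spec.choose.toMonoidHom).topologicalClosure) (Subgroup.le_topologicalClosure _) cuspMeetsH).Cor23i := by
  refine cor23i_ofSpecialFibre_closureH_of_mem_verticialSubgroups X d S h36 Sigma SigmaHat hsub hne hprime hp TpH
    cuspMeetsH hH ?_
  rw [map_topologicalClosure_eq_of_isCompact X d S h36 TpH (isCompact_of_mem_verticialSubgroups S.chart hH)]
  exact hhat'

end Compact

/-! ### C. The (i)–(iv) block over L3's `SpecialFibreTower.PiData` at `ℍ` = one vertex -/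

section Block

variable {p : ℕ} [Fact p.Prime] (X : TemperedCurve p) (d : X.GroupLevelData)
  (S : SpecialFibreData (X.toTemperedArithmeticGroup d)) (h36 : S.Gc.Prop36Hypotheses)
  (Sigma SigmaHat : Set ℕ) (hsub : Sigma ⊆ SigmaHat) (hne : Sigma.Nonempty)
  (hprime : ∀ q ∈ SigmaHat, q.Prime) (hp : p ∉ Sigma)
  (TpH : Subgroup S.chart.G)
  (cuspMeetsH : {x : X.Pt // X.IsCusp x} → Prop)
  (T : SpecialFibreTower X.DeltaTemp)

/-- **[IUTchI] Cor. 2.3 (i)–(iv) AS TYPED at the genuine datum, print's `Π̂_ℍ`, `Π^tp_ℍ := Π_v` VERTICIAL, over the `PiData`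
record**: binder list `{hhat, hHstab, hA, hB}` (the certificate route (α) list `{h22, hHstab, hA, hB}` with `h22` ↦ `hhat`: the
tempered clause is [SemiAnbd] Thm. 3.7 (ii), the other two clauses are not consumed).  Assembly = abc-iut-w4-d058's chain BY
NAME. [cite: Mochizuki2012, Cor 2.3 pp.47-49] -/
theorem cor23_i_to_iv_ofSpecialFibre_closureH_of_piData_of_mem_verticialSubgroups (P : SpecialFibreTower.PiData X d S T)
    (hA : (∃ l ∈ SigmaHat, l ∉ Sigma ∧ l ≠ p) →
      ∀ (i : ℕ) (a : (ofSpecialFibre X d S h36 Sigma SigmaHat hsub hne hprime hp TpH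
      ((TpH.map (TemperedGraphGroupData.exists_completion_of_prop36 S.Gc h36
        S.chart).choose_spec.choose.toMonoidHom).topologicalClosure) (Subgroup.le_topologicalClosure _) cuspMeetsH).DeltaHat),
        (∀ x ∈ ((OfSpecialFibre.towerOfSpecialFibreTower X d T Sigma SigmaHat hsub hne hprime S h36 hp TpH
        ((TpH.map (TemperedGraphGroupData.exists_completion_of_prop36 S.Gc h36
        S.chart).choose_spec.choose.toMonoidHom).topologicalClosure) (Subgroup.le_topologicalClosure _)
        cuspMeetsH).Jhat i).subgroupOf (ofSpecialFibre X d S h36 Sigma SigmaHat hsub hne hprime hp TpH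
      ((TpH.map (TemperedGraphGroupData.exists_completion_of_prop36 S.Gc h36
        S.chart).choose_spec.choose.toMonoidHom).topologicalClosure) (Subgroup.le_topologicalClosure _) cuspMeetsH).DeltaHat,
          x ∈ (ofSpecialFibre X d S h36 Sigma SigmaHat hsub hne hprime hp TpH
      ((TpH.map (TemperedGraphGroupData.exists_completion_of_prop36 S.Gc h36
        S.chart).choose_spec.choose.toMonoidHom).topologicalClosure) (Subgroup.le_topologicalClosure _) cuspMeetsH).ρHat.ker → a * x = x * a) →
        a ∈ ((OfSpecialFibre.towerOfSpecialFibreTower X d T Sigma SigmaHat hsub hne hprime S h36 hp TpH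
        ((TpH.map (TemperedGraphGroupData.exists_completion_of_prop36 S.Gc h36
        S.chart).choose_spec.choose.toMonoidHom).topologicalClosure) (Subgroup.le_topologicalClosure _)
        cuspMeetsH).Jhat i).subgroupOf (ofSpecialFibre X d S h36 Sigma SigmaHat hsub hne hprime hp TpH
      ((TpH.map (TemperedGraphGroupData.exists_completion_of_prop36 S.Gc h36
        S.chart).choose_spec.choose.toMonoidHom).topologicalClosure) (Subgroup.le_topologicalClosure _) cuspMeetsH).DeltaHat)
    (hB : SigmaHat = {q | q.Prime} →
      ∀ (i : ℕ) (a : (ofSpecialFibre X d S h36 Sigma SigmaHat hsub hne hprime hp TpH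
      ((TpH.map (TemperedGraphGroupData.exists_completion_of_prop36 S.Gc h36
        S.chart).choose_spec.choose.toMonoidHom).topologicalClosure) (Subgroup.le_topologicalClosure _) cuspMeetsH).DeltaHat),
        (∀ x ∈ ((OfSpecialFibre.towerOfSpecialFibreTower X d T Sigma SigmaHat hsub hne hprime S h36 hp TpH
        ((TpH.map (TemperedGraphGroupData.exists_completion_of_prop36 S.Gc h36
        S.chart).choose_spec.choose.toMonoidHom).topologicalClosure) (Subgroup.le_topologicalClosure _)
        cuspMeetsH).Jhat i).subgroupOf (ofSpecialFibre X d S h36 Sigma SigmaHat hsub hne hprime hp TpH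
      ((TpH.map (TemperedGraphGroupData.exists_completion_of_prop36 S.Gc h36
        S.chart).choose_spec.choose.toMonoidHom).topologicalClosure) (Subgroup.le_topologicalClosure _) cuspMeetsH).DeltaHat,
          x ∈ (ofSpecialFibre X d S h36 Sigma SigmaHat hsub hne hprime hp TpH
      ((TpH.map (TemperedGraphGroupData.exists_completion_of_prop36 S.Gc h36
        S.chart).choose_spec.choose.toMonoidHom).topologicalClosure) (Subgroup.le_topologicalClosure _) cuspMeetsH).ρHat.ker → a * x = x * a) →
        a ∈ ((OfSpecialFibre.towerOfSpecialFibreTower X d T Sigma SigmaHat hsub hne hprime S h36 hp TpH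
        ((TpH.map (TemperedGraphGroupData.exists_completion_of_prop36 S.Gc h36
        S.chart).choose_spec.choose.toMonoidHom).topologicalClosure) (Subgroup.le_topologicalClosure _)
        cuspMeetsH).Jhat i).subgroupOf (ofSpecialFibre X d S h36 Sigma SigmaHat hsub hne hprime hp TpH
      ((TpH.map (TemperedGraphGroupData.exists_completion_of_prop36 S.Gc h36
        S.chart).choose_spec.choose.toMonoidHom).topologicalClosure) (Subgroup.le_topologicalClosure _) cuspMeetsH).DeltaHat)
    {v : S.Gc.graph.Vertex} (hH : TpH ∈ verticialSubgroups S.chart v)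
    (hhat : IsCommensurablyTerminal ((TpH.map (TemperedGraphGroupData.exists_completion_of_prop36 S.Gc h36 S.chart).choose_spec.choose.toMonoidHom).topologicalClosure))
    (hHstab : ∀ g : X.PiTemp, ∃ t : S.chart.G,
      TpH.map (S.autOfConj P.admissibleKer_normal_pi g).toMulEquiv.toMonoidHom = MulAut.conj t • TpH) :
    (ofSpecialFibre X d S h36 Sigma SigmaHat hsub hne hprime hp TpH
      ((TpH.map (TemperedGraphGroupData.exists_completion_of_prop36 S.Gc h36
        S.chart).choose_spec.choose.toMonoidHom).topologicalClosure) (Subgroup.le_topologicalClosure _) cuspMeetsH).Cor23i ∧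
      (ofSpecialFibre X d S h36 Sigma SigmaHat hsub hne hprime hp TpH
      ((TpH.map (TemperedGraphGroupData.exists_completion_of_prop36 S.Gc h36
        S.chart).choose_spec.choose.toMonoidHom).topologicalClosure) (Subgroup.le_topologicalClosure _) cuspMeetsH).Cor23ii ∧
      (ofSpecialFibre X d S h36 Sigma SigmaHat hsub hne hprime hp TpH
      ((TpH.map (TemperedGraphGroupData.exists_completion_of_prop36 S.Gc h36
        S.chart).choose_spec.choose.toMonoidHom).topologicalClosure) (Subgroup.le_topologicalClosure _) cuspMeetsH).Cor23iii ∧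
      (ofSpecialFibre X d S h36 Sigma SigmaHat hsub hne hprime hp TpH
      ((TpH.map (TemperedGraphGroupData.exists_completion_of_prop36 S.Gc h36
        S.chart).choose_spec.choose.toMonoidHom).topologicalClosure) (Subgroup.le_topologicalClosure _) cuspMeetsH).Cor23iv := by
  haveI := ofSpecialFibre_t2Space_piHat X d S h36 Sigma SigmaHat hsub hne hprime hp TpH
      ((TpH.map (TemperedGraphGroupData.exists_completion_of_prop36 S.Gc h36
        S.chart).choose_spec.choose.toMonoidHom).topologicalClosure) (Subgroup.le_topologicalClosure _)
      cuspMeetsH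
  haveI := ofSpecialFibre_totallyDisconnectedSpace_piHat X d S h36 Sigma SigmaHat hsub hne hprime hp TpH
      ((TpH.map (TemperedGraphGroupData.exists_completion_of_prop36 S.Gc h36
        S.chart).choose_spec.choose.toMonoidHom).topologicalClosure) (Subgroup.le_topologicalClosure _)
      cuspMeetsH
  have hi : (ofSpecialFibre X d S h36 Sigma SigmaHat hsub hne hprime hp TpH
      ((TpH.map (TemperedGraphGroupData.exists_completion_of_prop36 S.Gc h36
        S.chart).choose_spec.choose.toMonoidHom).topologicalClosure) (Subgroup.le_topologicalClosure _) cuspMeetsH).Cor23i :=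
    cor23i_ofSpecialFibre_closureH_of_mem_verticialSubgroups X d S h36 Sigma SigmaHat hsub hne hprime hp TpH cuspMeetsH hH hhat
  have hii : (ofSpecialFibre X d S h36 Sigma SigmaHat hsub hne hprime hp TpH
      ((TpH.map (TemperedGraphGroupData.exists_completion_of_prop36 S.Gc h36
        S.chart).choose_spec.choose.toMonoidHom).topologicalClosure) (Subgroup.le_topologicalClosure _) cuspMeetsH).Cor23ii :=
    cor23ii_ofSpecialFibre X d S h36 Sigma SigmaHat hsub hne hprime hp TpH
      ((TpH.map (TemperedGraphGroupData.exists_completion_of_prop36 S.Gc h36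
        S.chart).choose_spec.choose.toMonoidHom).topologicalClosure) (Subgroup.le_topologicalClosure _)
      cuspMeetsH (by
      show ((((TpH.map (TemperedGraphGroupData.exists_completion_of_prop36 S.Gc h36 S.chart).choose_spec.choose.toMonoidHom).topologicalClosure) :
          Subgroup (TemperedGraphGroupData.exists_completion_of_prop36 S.Gc h36 S.chart).choose) : Set (TemperedGraphGroupData.exists_completion_of_prop36 S.Gc h36 S.chart).choose) =
        closure ((TemperedGraphGroupData.exists_completion_of_prop36 S.Gc h36 S.chart).choose_spec.choose.toMonoidHom '' (TpH : Set S.chart.G))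
      rw [Subgroup.topologicalClosure_coe, Subgroup.coe_map])
  have hOutTp := ofSpecialFibre_outerTp_of_graphStable X d S h36 Sigma SigmaHat hsub hne hprime hp TpH
      ((TpH.map (TemperedGraphGroupData.exists_completion_of_prop36 S.Gc h36
        S.chart).choose_spec.choose.toMonoidHom).topologicalClosure) (Subgroup.le_topologicalClosure _)
      cuspMeetsH
    P.admissibleKer_normal_pi hHstab
  have hOutHat := (ofSpecialFibre X d S h36 Sigma SigmaHat hsub hne hprime hp TpH
      ((TpH.map (TemperedGraphGroupData.exists_completion_of_prop36 S.Gc h36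
        S.chart).choose_spec.choose.toMonoidHom).topologicalClosure) (Subgroup.le_topologicalClosure _) cuspMeetsH).outerHat_of_outerTp hii hOutTp
  have hA' := fun ha => kerLevel_all_ofSpecialFibre_of_towerLevels X d S h36 Sigma SigmaHat hsub hne hprime hp TpH
      ((TpH.map (TemperedGraphGroupData.exists_completion_of_prop36 S.Gc h36
        S.chart).choose_spec.choose.toMonoidHom).topologicalClosure) (Subgroup.le_topologicalClosure _)
      cuspMeetsH T
    P.N_cofinal (hA ha)
  have hB' := fun hb => kerLevel_all_ofSpecialFibre_of_towerLevels X d S h36 Sigma SigmaHat hsub hne hprime hp TpH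
      ((TpH.map (TemperedGraphGroupData.exists_completion_of_prop36 S.Gc h36
        S.chart).choose_spec.choose.toMonoidHom).topologicalClosure) (Subgroup.le_topologicalClosure _)
      cuspMeetsH T
    P.N_cofinal (hB hb)
  have hslim : (ofSpecialFibre X d S h36 Sigma SigmaHat hsub hne hprime hp TpH
      ((TpH.map (TemperedGraphGroupData.exists_completion_of_prop36 S.Gc h36
        S.chart).choose_spec.choose.toMonoidHom).topologicalClosure) (Subgroup.le_topologicalClosure _) cuspMeetsH).Cor23Hyp →
      IsSlimGroup (ofSpecialFibre X d S h36 Sigma SigmaHat hsub hne hprime hp TpH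
      ((TpH.map (TemperedGraphGroupData.exists_completion_of_prop36 S.Gc h36
        S.chart).choose_spec.choose.toMonoidHom).topologicalClosure) (Subgroup.le_topologicalClosure _) cuspMeetsH).deltaHatH :=
    (ofSpecialFibre X d S h36 Sigma SigmaHat hsub hne hprime hp TpH
      ((TpH.map (TemperedGraphGroupData.exists_completion_of_prop36 S.Gc h36
        S.chart).choose_spec.choose.toMonoidHom).topologicalClosure) (Subgroup.le_topologicalClosure _) cuspMeetsH).slim_of_cor23Hyp_of_levels
      (ofSpecialFibre_isClosed_deltaHat X d S h36 Sigma SigmaHat hsub hne hprime hp TpH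
      ((TpH.map (TemperedGraphGroupData.exists_completion_of_prop36 S.Gc h36
        S.chart).choose_spec.choose.toMonoidHom).topologicalClosure) (Subgroup.le_topologicalClosure _)
      cuspMeetsH)
      (fun W : {W : Subgroup (ofSpecialFibre X d S h36 Sigma SigmaHat hsub hne hprime hp TpH
      ((TpH.map (TemperedGraphGroupData.exists_completion_of_prop36 S.Gc h36
        S.chart).choose_spec.choose.toMonoidHom).topologicalClosure) (Subgroup.le_topologicalClosure _) cuspMeetsH).DeltaHat //
          W.Normal ∧ IsOpen (W : Set (ofSpecialFibre X d S h36 Sigma SigmaHat hsub hne hprime hp TpH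
      ((TpH.map (TemperedGraphGroupData.exists_completion_of_prop36 S.Gc h36
        S.chart).choose_spec.choose.toMonoidHom).topologicalClosure) (Subgroup.le_topologicalClosure _) cuspMeetsH).DeltaHat)} => W.1)
      (fun W hn ho => ⟨⟨W, hn, ho⟩, le_rfl⟩)
      (fun ha i a h => hA' ha i.1 i.2.1 i.2.2 a fun x hxJ hxK =>
        h x hxJ ((ofSpecialFibre X d S h36 Sigma SigmaHat hsub hne hprime hp TpH
      ((TpH.map (TemperedGraphGroupData.exists_completion_of_prop36 S.Gc h36
        S.chart).choose_spec.choose.toMonoidHom).topologicalClosure) (Subgroup.le_topologicalClosure _) cuspMeetsH).ker_ρHat_le_deltaHatH hxK))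
      (fun hb i a h => hB' hb i.1 i.2.1 i.2.2 a fun x hxJ hxK =>
        h x hxJ ((ofSpecialFibre X d S h36 Sigma SigmaHat hsub hne hprime hp TpH
      ((TpH.map (TemperedGraphGroupData.exists_completion_of_prop36 S.Gc h36
        S.chart).choose_spec.choose.toMonoidHom).topologicalClosure) (Subgroup.le_topologicalClosure _) cuspMeetsH).ker_ρHat_le_deltaHatH hxK))
  exact ⟨hi, hii,
    cor23iii_ofSpecialFibre_of_slim X d S h36 Sigma SigmaHat hsub hne hprime hp TpH
      ((TpH.map (TemperedGraphGroupData.exists_completion_of_prop36 S.Gc h36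
        S.chart).choose_spec.choose.toMonoidHom).topologicalClosure) (Subgroup.le_topologicalClosure _)
      cuspMeetsH hi hii hslim hOutTp hOutHat,
    cor23iv_ofSpecialFibre_of_slim X d S h36 Sigma SigmaHat hsub hne hprime hp TpH
      ((TpH.map (TemperedGraphGroupData.exists_completion_of_prop36 S.Gc h36
        S.chart).choose_spec.choose.toMonoidHom).topologicalClosure) (Subgroup.le_topologicalClosure _)
      cuspMeetsH hi hii hslim hOutTp hOutHat⟩

/-- **Rows (i)–(v) together at `ℍ` = one vertex**: the block above AND Cor. 2.3 (v) unconditionally — at this `ℍ` the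
certificate's §2 laws `{h22, hHstab, hA, hB, hv}` for (i)–(v) read `{hhat, hHstab, hA, hB}`. [cite: Mochizuki2012, Cor 2.3 pp.47-50] -/
theorem cor23_i_to_v_ofSpecialFibre_closureH_of_piData_of_mem_verticialSubgroups (P : SpecialFibreTower.PiData X d S T)
    (hA : (∃ l ∈ SigmaHat, l ∉ Sigma ∧ l ≠ p) →
      ∀ (i : ℕ) (a : (ofSpecialFibre X d S h36 Sigma SigmaHat hsub hne hprime hp TpH
      ((TpH.map (TemperedGraphGroupData.exists_completion_of_prop36 S.Gc h36
        S.chart).choose_spec.choose.toMonoidHom).topologicalClosure) (Subgroup.le_topologicalClosure _) cuspMeetsH).DeltaHat),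
        (∀ x ∈ ((OfSpecialFibre.towerOfSpecialFibreTower X d T Sigma SigmaHat hsub hne hprime S h36 hp TpH
        ((TpH.map (TemperedGraphGroupData.exists_completion_of_prop36 S.Gc h36
        S.chart).choose_spec.choose.toMonoidHom).topologicalClosure) (Subgroup.le_topologicalClosure _)
        cuspMeetsH).Jhat i).subgroupOf (ofSpecialFibre X d S h36 Sigma SigmaHat hsub hne hprime hp TpH
      ((TpH.map (TemperedGraphGroupData.exists_completion_of_prop36 S.Gc h36
        S.chart).choose_spec.choose.toMonoidHom).topologicalClosure) (Subgroup.le_topologicalClosure _) cuspMeetsH).DeltaHat,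
          x ∈ (ofSpecialFibre X d S h36 Sigma SigmaHat hsub hne hprime hp TpH
      ((TpH.map (TemperedGraphGroupData.exists_completion_of_prop36 S.Gc h36
        S.chart).choose_spec.choose.toMonoidHom).topologicalClosure) (Subgroup.le_topologicalClosure _) cuspMeetsH).ρHat.ker → a * x = x * a) →
        a ∈ ((OfSpecialFibre.towerOfSpecialFibreTower X d T Sigma SigmaHat hsub hne hprime S h36 hp TpH
        ((TpH.map (TemperedGraphGroupData.exists_completion_of_prop36 S.Gc h36
        S.chart).choose_spec.choose.toMonoidHom).topologicalClosure) (Subgroup.le_topologicalClosure _)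
        cuspMeetsH).Jhat i).subgroupOf (ofSpecialFibre X d S h36 Sigma SigmaHat hsub hne hprime hp TpH
      ((TpH.map (TemperedGraphGroupData.exists_completion_of_prop36 S.Gc h36
        S.chart).choose_spec.choose.toMonoidHom).topologicalClosure) (Subgroup.le_topologicalClosure _) cuspMeetsH).DeltaHat)
    (hB : SigmaHat = {q | q.Prime} →
      ∀ (i : ℕ) (a : (ofSpecialFibre X d S h36 Sigma SigmaHat hsub hne hprime hp TpH
      ((TpH.map (TemperedGraphGroupData.exists_completion_of_prop36 S.Gc h36
        S.chart).choose_spec.choose.toMonoidHom).topologicalClosure) (Subgroup.le_topologicalClosure _) cuspMeetsH).DeltaHat),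
        (∀ x ∈ ((OfSpecialFibre.towerOfSpecialFibreTower X d T Sigma SigmaHat hsub hne hprime S h36 hp TpH
        ((TpH.map (TemperedGraphGroupData.exists_completion_of_prop36 S.Gc h36
        S.chart).choose_spec.choose.toMonoidHom).topologicalClosure) (Subgroup.le_topologicalClosure _)
        cuspMeetsH).Jhat i).subgroupOf (ofSpecialFibre X d S h36 Sigma SigmaHat hsub hne hprime hp TpH
      ((TpH.map (TemperedGraphGroupData.exists_completion_of_prop36 S.Gc h36
        S.chart).choose_spec.choose.toMonoidHom).topologicalClosure) (Subgroup.le_topologicalClosure _) cuspMeetsH).DeltaHat,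
          x ∈ (ofSpecialFibre X d S h36 Sigma SigmaHat hsub hne hprime hp TpH
      ((TpH.map (TemperedGraphGroupData.exists_completion_of_prop36 S.Gc h36
        S.chart).choose_spec.choose.toMonoidHom).topologicalClosure) (Subgroup.le_topologicalClosure _) cuspMeetsH).ρHat.ker → a * x = x * a) →
        a ∈ ((OfSpecialFibre.towerOfSpecialFibreTower X d T Sigma SigmaHat hsub hne hprime S h36 hp TpH
        ((TpH.map (TemperedGraphGroupData.exists_completion_of_prop36 S.Gc h36
        S.chart).choose_spec.choose.toMonoidHom).topologicalClosure) (Subgroup.le_topologicalClosure _)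
        cuspMeetsH).Jhat i).subgroupOf (ofSpecialFibre X d S h36 Sigma SigmaHat hsub hne hprime hp TpH
      ((TpH.map (TemperedGraphGroupData.exists_completion_of_prop36 S.Gc h36
        S.chart).choose_spec.choose.toMonoidHom).topologicalClosure) (Subgroup.le_topologicalClosure _) cuspMeetsH).DeltaHat)
    {v : S.Gc.graph.Vertex} (hH : TpH ∈ verticialSubgroups S.chart v)
    (hhat : IsCommensurablyTerminal ((TpH.map (TemperedGraphGroupData.exists_completion_of_prop36 S.Gc h36 S.chart).choose_spec.choose.toMonoidHom).topologicalClosure))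
    (hHstab : ∀ g : X.PiTemp, ∃ t : S.chart.G,
      TpH.map (S.autOfConj P.admissibleKer_normal_pi g).toMulEquiv.toMonoidHom = MulAut.conj t • TpH) :
    ((ofSpecialFibre X d S h36 Sigma SigmaHat hsub hne hprime hp TpH
      ((TpH.map (TemperedGraphGroupData.exists_completion_of_prop36 S.Gc h36
        S.chart).choose_spec.choose.toMonoidHom).topologicalClosure) (Subgroup.le_topologicalClosure _) cuspMeetsH).Cor23i ∧
      (ofSpecialFibre X d S h36 Sigma SigmaHat hsub hne hprime hp TpH
      ((TpH.map (TemperedGraphGroupData.exists_completion_of_prop36 S.Gc h36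
        S.chart).choose_spec.choose.toMonoidHom).topologicalClosure) (Subgroup.le_topologicalClosure _) cuspMeetsH).Cor23ii ∧
      (ofSpecialFibre X d S h36 Sigma SigmaHat hsub hne hprime hp TpH
      ((TpH.map (TemperedGraphGroupData.exists_completion_of_prop36 S.Gc h36
        S.chart).choose_spec.choose.toMonoidHom).topologicalClosure) (Subgroup.le_topologicalClosure _) cuspMeetsH).Cor23iii ∧
      (ofSpecialFibre X d S h36 Sigma SigmaHat hsub hne hprime hp TpH
      ((TpH.map (TemperedGraphGroupData.exists_completion_of_prop36 S.Gc h36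
        S.chart).choose_spec.choose.toMonoidHom).topologicalClosure) (Subgroup.le_topologicalClosure _) cuspMeetsH).Cor23iv) ∧
      (ofSpecialFibre X d S h36 Sigma SigmaHat hsub hne hprime hp TpH
      ((TpH.map (TemperedGraphGroupData.exists_completion_of_prop36 S.Gc h36
        S.chart).choose_spec.choose.toMonoidHom).topologicalClosure) (Subgroup.le_topologicalClosure _) cuspMeetsH).Cor23v :=
  ⟨cor23_i_to_iv_ofSpecialFibre_closureH_of_piData_of_mem_verticialSubgroups X d S h36 Sigma SigmaHat hsub hne hprime hp TpH cuspMeetsH T P hA hB hH hhat hHstab,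
    cor23v_ofSpecialFibre_closureH_of_mem_verticialSubgroups X d S h36 Sigma SigmaHat hsub hne hprime hp TpH cuspMeetsH hH⟩

end Block

end StableCurveTemperedData

end Literature.IUT.HodgeTheaters

end
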